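import Mathlib.RingTheory.MvPolynomial.Symmetric.Defs
import Mathlib.Analysis.Complex.Basic
import Mathlib.Tactic
import Literature.Geometry.Riemannian.TwoConvexSchoenfliesProofs
import Summits.CriticalPhenomena.PercolationContinuityZ3.Theorems.PercNearOneGluingNoHeavyLowerTailFederMihail
import Summits.CriticalPhenomena.PercolationContinuityZ3.Theorems.PercNearOneGluingNoHeavyLowerTailSiteLevelFamily
import Summits.CriticalPhenomena.PercolationContinuityZ3.Theorems.PercNearOneGluingNoHeavyLowerTailSiteCovariancePrelims
import HarnessLib

/-!
# Positive correlation of an X-site and a Y-site in the conditioned site model (THEOREM COV)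

Support file for the Sahi / Conjecture-P programme of route `PercNearOneGluingNoHeavy`
(`--supports stmt-CriticalPhenomena-4575`, prover prim-l12-p5 gen 31; proof note
`prim-l12-p5/MULTITYPE-PROOF-g31.md` §1, §4).  No definitions, no named facts, no sorries.

SITE MODEL: sites `s ∈ S` with states `κ(s) ∈ {0,1,2}` (`0` empty, `1` = `X`, `2` = `Y`) and
weights `1, P_s, Q_s ≥ 0`; configurations `κ : S → Fin 3` with weight `w(κ) = ∏_s w_s(κ s)`,
CONDITIONED on the quotas `#κ⁻¹(1) = A`, `#κ⁻¹(2) = C`.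

**THEOREM COV** (`site_covariance`).  If `s₁ ≠ s₂` and the `X`-weight of `s₂` is maximal
(`P_s ≤ P_{s₂}` for all `s`), then the events `{κ(s₁) = X}` and `{κ(s₂) = Y}` are POSITIVELY
correlated:  `W(κ s₁ = X) · W(κ s₂ = Y) ≤ W(κ s₁ = X, κ s₂ = Y) · W(all)` (sums of `w` over the
conditioned configurations).  With `T` copies of a multi-type de Finetti law (`p_τ, q_τ ≤ 1`) and
`N + 1` neutral sites this is exactly LSM-Z-2D (THEOREM MT), see `…LowerTailMultiTypeLSM`; only
`p_τ ≤ 1 = P(neutral)` is used — the theorem is one-sided.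

Proof.  Condition on the `Y`-set `Y₀ = κ⁻¹(2)`: its law `ν` is the homogeneous stable-or-zero
family of `…SiteLevelFamily.siteLevel_stableOrZero_XY`; given `Y₀`, the `X`-set is a conditional
Poisson sample of size `A` from `S ∖ Y₀`, so `W(κ s₁ = X | Y₀) / ν(Y₀) = Φ(Y₀)` is the inclusion
probability of `s₁`.  SWAP MONOTONICITY (`swap_ineq`): for `Y₀ ∋ s₂` and `g ∉ Y₀`,
`Φ(Y₀ ∖ s₂ ∪ g) ≤ Φ(Y₀)` — the ground sets differ by exchanging the competitor `g` (weight `P_g`)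
for `s₂` (weight `P_{s₂} ≥ P_g`), and the inclusion probability of `s₁` is antitone in a
competitor's weight (`SiteCovariance.esymm_swap` ← `CPMonotone.cp_inclusion_antitone`).  The
Feder–Mihail inequality (`FederMihail.feder_mihail_univ`) for `ν`, the coordinate `s₂` and
`F = −Φ` is the claim.

* `swap_ineq` : swap monotonicity in cross-multiplied form;
* `site_covariance` : THEOREM COV;
* `site_negative_correlation` : like colours repel (two `Y`-indicators are negatively correlated).
-/

namespace Summit.CriticalPhenomena.PercolationContinuityZ3.Theorems

namespace SiteCovariance

open Finset Literature.Geometry.Riemannian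

variable {S : Type*} [Fintype S] [DecidableEq S]

/-- **Swap monotonicity of the inclusion probability of `s₁`** (cross-multiplied form).  With
`ν(Y) = [|Y| = C] Q^Y e_{A'+1}(P | S∖Y)` and `N(Y) = [|Y| = C][s₁ ∉ Y] Q^Y P_{s₁} e_{A'}(P | S∖Y∖s₁)`:
for `s₂ ∈ Y₀`, `g ∉ Y₀`, `Y₁ = Y₀ ∖ s₂ ∪ g` and `P_g ≤ P_{s₂}`,  `N(Y₁) ν(Y₀) ≤ N(Y₀) ν(Y₁)`. -/
theorem swap_ineq (P Q : S → ℝ) (hP : ∀ s, 0 ≤ P s) (hQ : ∀ s, 0 ≤ Q s) (A' C : ℕ) (s₁ s₂ : S)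
    (hne : s₁ ≠ s₂) (Y₀ : Finset S) (hs₂ : s₂ ∈ Y₀) (g : S) (hg : g ∉ Y₀) (hPg : P g ≤ P s₂) :
    ((if (insert g (Y₀.erase s₂)).card = C ∧ s₁ ∉ insert g (Y₀.erase s₂) then 1 else 0) *
        (∏ s ∈ insert g (Y₀.erase s₂), Q s) *
        (P s₁ * (((univ \ insert g (Y₀.erase s₂)).erase s₁).val.map P).esymm A')) *
      ((if Y₀.card = C then 1 else 0) * (∏ s ∈ Y₀, Q s) * ((univ \ Y₀).val.map P).esymm (A' + 1)) ≤
    ((if Y₀.card = C ∧ s₁ ∉ Y₀ then 1 else 0) * (∏ s ∈ Y₀, Q s) *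
        (P s₁ * (((univ \ Y₀).erase s₁).val.map P).esymm A')) *
      ((if (insert g (Y₀.erase s₂)).card = C then 1 else 0) * (∏ s ∈ insert g (Y₀.erase s₂), Q s) *
        ((univ \ insert g (Y₀.erase s₂)).val.map P).esymm (A' + 1)) := by
  set Y₁ := insert g (Y₀.erase s₂) with hY₁
  have hgs₂ : g ≠ s₂ := fun h => hg (h ▸ hs₂)
  have hgY : g ∉ Y₀.erase s₂ := fun h => hg (Finset.mem_of_mem_erase h)
  have hcard : Y₁.card = Y₀.card := by
    rw [hY₁, Finset.card_insert_of_notMem hgY, Finset.card_erase_of_mem hs₂]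
    have := Finset.card_pos.2 ⟨s₂, hs₂⟩
    omega
  -- non-negativity of all factors
  have hQ0 : ∀ T : Finset S, 0 ≤ ∏ s ∈ T, Q s := fun T => Finset.prod_nonneg fun s _ => hQ s
  have hE : ∀ (T : Finset S) (k : ℕ), 0 ≤ (T.val.map P).esymm k := fun T k =>
    esymm_nonneg_of_forall_nonneg _ (map_val_nonneg P hP T) k
  by_cases hC : Y₀.card = C
  swap
  · rw [if_neg hC, show (if Y₁.card = C then (1:ℝ) else 0) = 0 from if_neg (hcard ▸ hC)]
    simp
  by_cases hs1 : s₁ ∈ Y₁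
  · -- `N(Y₁) = 0`
    rw [if_neg (fun h => h.2 hs1)]
    simp only [zero_mul]
    refine mul_nonneg (mul_nonneg (mul_nonneg ?_ (hQ0 _)) (mul_nonneg (hP s₁) (hE _ _)))
      (mul_nonneg (mul_nonneg ?_ (hQ0 _)) (hE _ _)) <;> split_ifs <;> norm_num
  -- main case: `s₁ ∉ Y₁`, hence `s₁ ≠ g` and `s₁ ∉ Y₀`
  have hs1g : s₁ ≠ g := fun h => hs1 (h ▸ Finset.mem_insert_self g _)
  have hs1Y : s₁ ∉ Y₀ := fun h =>
    hs1 (Finset.mem_insert_of_mem (Finset.mem_erase.2 ⟨hne, h⟩))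
  rw [if_pos ⟨hcard.trans hC, hs1⟩, if_pos hC, if_pos ⟨hC, hs1Y⟩, if_pos (hcard.trans hC)]
  -- the ground sets
  set G := (univ \ Y₀).erase g with hG
  have hs1G : s₁ ∈ G := Finset.mem_erase.2 ⟨hs1g, Finset.mem_sdiff.2 ⟨Finset.mem_univ _, hs1Y⟩⟩
  have hgG : g ∉ G := Finset.notMem_erase g _
  have hs₂G : s₂ ∉ G := fun h => (Finset.mem_sdiff.1 (Finset.mem_of_mem_erase h)).2 hs₂
  have f1 : univ \ Y₀ = insert g G := by
    rw [hG, Finset.insert_erase (Finset.mem_sdiff.2 ⟨Finset.mem_univ _, hg⟩)]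
  have f2 : univ \ Y₁ = insert s₂ G := by
    ext x
    simp only [hY₁, hG, Finset.mem_sdiff, Finset.mem_univ, true_and, Finset.mem_insert,
      Finset.mem_erase]
    constructor
    · intro hx
      by_cases hxs : x = s₂
      · exact Or.inl hxs
      · right
        refine ⟨fun hxg => hx (Or.inl hxg), fun hxY => hx (Or.inr ⟨hxs, hxY⟩)⟩
    · rintro (rfl | ⟨hxg, hxY⟩)
      · rintro (h | ⟨h, _⟩)
        · exact hgs₂ h.symm
        · exact h rfl
      · rintro (h | ⟨_, h⟩)
        · exact hxg h
        · exact hxY h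
  have f3 : (insert g G).erase s₁ = insert g (G.erase s₁) := Finset.erase_insert_of_ne hs1g.symm
  have f4 : (insert s₂ G).erase s₁ = insert s₂ (G.erase s₁) := Finset.erase_insert_of_ne hne.symm
  rw [f1, f2, f3, f4]
  have hGval : G.val.map P = P s₁ ::ₘ (G.erase s₁).val.map P := by
    conv_lhs => rw [(Finset.insert_erase hs1G).symm]
    rw [map_insert_val P (Finset.notMem_erase s₁ G)]
  have hg' : g ∉ G.erase s₁ := fun h => hgG (Finset.mem_of_mem_erase h)
  have hs₂' : s₂ ∉ G.erase s₁ := fun h => hs₂G (Finset.mem_of_mem_erase h)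
  rw [map_insert_val P hgG, map_insert_val P hs₂G, map_insert_val P hg', map_insert_val P hs₂', hGval]
  have hM0 : ∀ y ∈ (G.erase s₁).val.map P, 0 ≤ y := map_val_nonneg P hP _
  have core := esymm_swap ((G.erase s₁).val.map P) hM0 A' (P g) (P s₂) (P s₁) hPg
  have hK : 0 ≤ (∏ s ∈ Y₁, Q s) * (∏ s ∈ Y₀, Q s) * P s₁ :=
    mul_nonneg (mul_nonneg (hQ0 _) (hQ0 _)) (hP s₁)
  have := mul_le_mul_of_nonneg_left core hK
  simp only [one_mul]
  nlinarith [this]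

/-! ### THEOREM COV -/

/-- **THEOREM COV (positive correlation of an `X`-site and a `Y`-site).**  In the site model with
non-negative weights, conditioned on the quotas `#X = A`, `#Y = C`, let `s₁ ≠ s₂` with `P_{s₂}`
maximal among the `X`-weights.  Then
`W(κ s₁ = X) · W(κ s₂ = Y) ≤ W(κ s₁ = X ∧ κ s₂ = Y) · W(all)`
(unnormalised weights of the conditioned configurations), i.e. `Cov(1[κ s₁ = X], 1[κ s₂ = Y]) ≥ 0`. -/
theorem site_covariance (P Q : S → ℝ) (hP : ∀ s, 0 ≤ P s) (hQ : ∀ s, 0 ≤ Q s) (s₁ s₂ : S)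
    (hne : s₁ ≠ s₂) (hmax : ∀ s, P s ≤ P s₂) (A C : ℕ) :
    (∑ κ ∈ univ.filter (fun κ : S → Fin 3 => ((univ.filter (fun s => κ s = 1)).card = A ∧
        (univ.filter (fun s => κ s = 2)).card = C) ∧ κ s₁ = 1),
        ∏ s, (if κ s = 1 then P s else if κ s = 2 then Q s else 1)) *
      (∑ κ ∈ univ.filter (fun κ : S → Fin 3 => ((univ.filter (fun s => κ s = 1)).card = A ∧
        (univ.filter (fun s => κ s = 2)).card = C) ∧ κ s₂ = 2),
        ∏ s, (if κ s = 1 then P s else if κ s = 2 then Q s else 1)) ≤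
    (∑ κ ∈ univ.filter (fun κ : S → Fin 3 => ((univ.filter (fun s => κ s = 1)).card = A ∧
        (univ.filter (fun s => κ s = 2)).card = C) ∧ (κ s₁ = 1 ∧ κ s₂ = 2)),
        ∏ s, (if κ s = 1 then P s else if κ s = 2 then Q s else 1)) *
      (∑ κ ∈ univ.filter (fun κ : S → Fin 3 => (univ.filter (fun s => κ s = 1)).card = A ∧
        (univ.filter (fun s => κ s = 2)).card = C),
        ∏ s, (if κ s = 1 then P s else if κ s = 2 then Q s else 1)) := by
  have hw0 := weight_nonneg P Q hP hQ
  cases A with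
  | zero =>
    -- no configuration with `#X = 0` has `κ s₁ = X`
    have hz : ∀ p : (S → Fin 3) → Prop, ∀ [DecidablePred p],
        ∑ κ ∈ univ.filter (fun κ : S → Fin 3 => ((univ.filter (fun s => κ s = 1)).card = 0 ∧
          (univ.filter (fun s => κ s = 2)).card = C) ∧ (κ s₁ = 1 ∧ p κ)),
          ∏ s, (if κ s = 1 then P s else if κ s = 2 then Q s else 1) = 0 := by
      intro p _
      refine Finset.sum_eq_zero fun κ hκ => ?_
      exfalso
      obtain ⟨⟨h0, _⟩, h1, _⟩ := (Finset.mem_filter.1 hκ).2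
      have : s₁ ∈ univ.filter (fun s => κ s = 1) := Finset.mem_filter.2 ⟨Finset.mem_univ _, h1⟩
      rw [Finset.card_eq_zero.1 h0] at this
      exact absurd this (Finset.notMem_empty _)
    have h1 := hz (fun _ => True)
    have h2 := hz (fun κ => κ s₂ = 2)
    simp only [and_true] at h1
    rw [h1, h2, zero_mul, zero_mul]
  | succ A' =>
    -- the level family ν and its X-marked version N
    set ν : Finset S → ℝ := fun Y₀ => ∑ κ ∈ univ.filter (fun κ : S → Fin 3 =>
        univ.filter (fun s => κ s = 2) = Y₀ ∧ (univ.filter (fun s => κ s = 1)).card = A' + 1 ∧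
          (univ.filter (fun s => κ s = 2)).card = C),
        ∏ s, (if κ s = 1 then P s else if κ s = 2 then Q s else 1) with hν
    set N : Finset S → ℝ := fun Y₀ => ∑ κ ∈ univ.filter (fun κ : S → Fin 3 =>
        univ.filter (fun s => κ s = 2) = Y₀ ∧ (((univ.filter (fun s => κ s = 1)).card = A' + 1 ∧
          (univ.filter (fun s => κ s = 2)).card = C) ∧ κ s₁ = 1)),
        ∏ s, (if κ s = 1 then P s else if κ s = 2 then Q s else 1) with hN
    have hν0 : ∀ Y₀, 0 ≤ ν Y₀ := fun Y₀ => Finset.sum_nonneg fun κ _ => hw0 κ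
    have hN0 : ∀ Y₀, 0 ≤ N Y₀ := fun Y₀ => Finset.sum_nonneg fun κ _ => hw0 κ
    have hNle : ∀ Y₀, N Y₀ ≤ ν Y₀ := fun Y₀ =>
      Finset.sum_le_sum_of_subset_of_nonneg
        (fun κ hκ => by
          have h := (Finset.mem_filter.1 hκ).2
          exact Finset.mem_filter.2 ⟨Finset.mem_univ _, h.1, h.2.1⟩)
        (fun κ _ _ => hw0 κ)
    -- hypotheses of the Feder–Mihail inequality
    have hst : (∀ Y₀, ν Y₀ = 0) ∨ ∀ z : S → ℂ, (∀ s, 0 < (z s).im) →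
        (∑ Y₀ : Finset S, (ν Y₀ : ℂ) * ∏ s ∈ Y₀, z s) ≠ 0 :=
      SiteLevelFamily.siteLevel_stableOrZero_XY P Q hP hQ (A' + 1) C
    have hhom : ∀ Y₀, ν Y₀ ≠ 0 → Y₀.card = C := by
      intro Y₀ h
      by_contra hc
      apply h
      show ν Y₀ = 0
      simp only [hν]
      rw [level_eq, if_neg hc, zero_mul, zero_mul]
    have hswap : ∀ Y₀, ν Y₀ ≠ 0 → s₂ ∈ Y₀ → ∀ g, g ∉ Y₀ →
        (fun Y => -(N Y / ν Y)) Y₀ ≤ (fun Y => -(N Y / ν Y)) (insert g (Y₀.erase s₂)) := by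
      intro Y₀ hY₀ hs₂ g hg
      show -(N Y₀ / ν Y₀) ≤ -(N (insert g (Y₀.erase s₂)) / ν (insert g (Y₀.erase s₂)))
      apply neg_le_neg
      by_cases h1 : ν (insert g (Y₀.erase s₂)) = 0
      · rw [h1, div_zero]
        exact div_nonneg (hN0 _) (hν0 _)
      rw [div_le_div_iff₀ (lt_of_le_of_ne (hν0 _) (Ne.symm h1)) (lt_of_le_of_ne (hν0 _) (Ne.symm hY₀))]
      have key := swap_ineq P Q hP hQ A' C s₁ s₂ hne Y₀ hs₂ g hg (hmax g)
      rw [← levelX_eq, ← levelX_eq, ← level_eq, ← level_eq] at key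
      exact key
    have FM := FederMihail.feder_mihail_univ ν C (fun Y => -(N Y / ν Y)) s₂ hν0 hst hhom hswap
    -- ν F = -N
    have hνF : ∀ Y₀, ν Y₀ * -(N Y₀ / ν Y₀) = -N Y₀ := by
      intro Y₀
      by_cases h : ν Y₀ = 0
      · have h' : N Y₀ = 0 := le_antisymm (h ▸ hNle Y₀) (hN0 Y₀)
        rw [h, h']; simp
      · field_simp
    simp only [hνF, Finset.sum_neg_distrib, neg_mul, neg_le_neg_iff] at FM
    -- identification of the four sums
    have e1 : ∑ Y₀, ν Y₀ = ∑ κ ∈ univ.filter (fun κ : S → Fin 3 =>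
        (univ.filter (fun s => κ s = 1)).card = A' + 1 ∧ (univ.filter (fun s => κ s = 2)).card = C),
        ∏ s, (if κ s = 1 then P s else if κ s = 2 then Q s else 1) := by
      simp only [hν]
      rw [regroup]
      exact Finset.sum_congr (Finset.filter_congr fun κ _ => by simp) fun _ _ => rfl
    have e2 : ∑ Y₀ ∈ univ.filter (fun Y₀ : Finset S => s₂ ∈ Y₀), ν Y₀ =
        ∑ κ ∈ univ.filter (fun κ : S → Fin 3 => ((univ.filter (fun s => κ s = 1)).card = A' + 1 ∧
          (univ.filter (fun s => κ s = 2)).card = C) ∧ κ s₂ = 2),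
        ∏ s, (if κ s = 1 then P s else if κ s = 2 then Q s else 1) := by
      simp only [hν]
      rw [regroup]
      exact Finset.sum_congr (Finset.filter_congr fun κ _ => by simp) fun _ _ => rfl
    have e3 : ∑ Y₀, N Y₀ = ∑ κ ∈ univ.filter (fun κ : S → Fin 3 =>
        ((univ.filter (fun s => κ s = 1)).card = A' + 1 ∧ (univ.filter (fun s => κ s = 2)).card = C) ∧
          κ s₁ = 1),
        ∏ s, (if κ s = 1 then P s else if κ s = 2 then Q s else 1) := by
      simp only [hN]
      rw [regroup]
      exact Finset.sum_congr (Finset.filter_congr fun κ _ => by simp) fun _ _ => rfl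
    have e4 : ∑ Y₀ ∈ univ.filter (fun Y₀ : Finset S => s₂ ∈ Y₀), N Y₀ =
        ∑ κ ∈ univ.filter (fun κ : S → Fin 3 => ((univ.filter (fun s => κ s = 1)).card = A' + 1 ∧
          (univ.filter (fun s => κ s = 2)).card = C) ∧ (κ s₁ = 1 ∧ κ s₂ = 2)),
        ∏ s, (if κ s = 1 then P s else if κ s = 2 then Q s else 1) := by
      simp only [hN]
      rw [regroup]
      exact Finset.sum_congr (Finset.filter_congr fun κ _ => by simp [and_assoc]) fun _ _ => rfl
    rw [e1, e2, e3, e4] at FM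
    linarith [FM]


/-- **Like colours repel**: in the conditioned site model (any non-negative weights, any quotas),
two `Y`-indicators are NEGATIVELY correlated:
`W(κ s₁ = Y, κ s₂ = Y) · W(all) ≤ W(κ s₁ = Y) · W(κ s₂ = Y)` for `s₁ ≠ s₂`
(pairwise negative correlation of the strongly Rayleigh `Y`-site family,
`multiAffine_pairwise_negCorr` of the tree).  By the relabelling `X ↔ Y` the same holds for two
`X`-indicators. -/
theorem site_negative_correlation (P Q : S → ℝ) (hP : ∀ s, 0 ≤ P s) (hQ : ∀ s, 0 ≤ Q s) (s₁ s₂ : S)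
    (hne : s₁ ≠ s₂) (A C : ℕ) :
    (∑ κ ∈ univ.filter (fun κ : S → Fin 3 => ((univ.filter (fun s => κ s = 1)).card = A ∧
        (univ.filter (fun s => κ s = 2)).card = C) ∧ (κ s₁ = 2 ∧ κ s₂ = 2)),
        ∏ s, (if κ s = 1 then P s else if κ s = 2 then Q s else 1)) *
      (∑ κ ∈ univ.filter (fun κ : S → Fin 3 => (univ.filter (fun s => κ s = 1)).card = A ∧
        (univ.filter (fun s => κ s = 2)).card = C),
        ∏ s, (if κ s = 1 then P s else if κ s = 2 then Q s else 1)) ≤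
    (∑ κ ∈ univ.filter (fun κ : S → Fin 3 => ((univ.filter (fun s => κ s = 1)).card = A ∧
        (univ.filter (fun s => κ s = 2)).card = C) ∧ κ s₁ = 2),
        ∏ s, (if κ s = 1 then P s else if κ s = 2 then Q s else 1)) *
      (∑ κ ∈ univ.filter (fun κ : S → Fin 3 => ((univ.filter (fun s => κ s = 1)).card = A ∧
        (univ.filter (fun s => κ s = 2)).card = C) ∧ κ s₂ = 2),
        ∏ s, (if κ s = 1 then P s else if κ s = 2 then Q s else 1)) := by
  set ν : Finset S → ℝ := fun Y₀ => ∑ κ ∈ univ.filter (fun κ : S → Fin 3 =>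
      univ.filter (fun s => κ s = 2) = Y₀ ∧ (univ.filter (fun s => κ s = 1)).card = A ∧
        (univ.filter (fun s => κ s = 2)).card = C),
      ∏ s, (if κ s = 1 then P s else if κ s = 2 then Q s else 1) with hν
  have hst : (∀ Y₀, ν Y₀ = 0) ∨ ∀ z : S → ℂ, (∀ s, 0 < (z s).im) →
      (∑ Y₀ : Finset S, (ν Y₀ : ℂ) * ∏ s ∈ Y₀, z s) ≠ 0 :=
    SiteLevelFamily.siteLevel_stableOrZero_XY P Q hP hQ A C
  have PNC := Literature.Combinatorics.StablePolynomials.multiAffine_pairwise_negCorr ν hst hne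
  have e0 : ∑ Y₀, ν Y₀ = ∑ κ ∈ univ.filter (fun κ : S → Fin 3 =>
      (univ.filter (fun s => κ s = 1)).card = A ∧ (univ.filter (fun s => κ s = 2)).card = C),
      ∏ s, (if κ s = 1 then P s else if κ s = 2 then Q s else 1) := by
    simp only [hν]; rw [regroup]
    exact Finset.sum_congr (Finset.filter_congr fun κ _ => by simp) fun _ _ => rfl
  have e1 : ∀ s₀ : S, ∑ Y₀ ∈ univ.filter (fun Y₀ : Finset S => s₀ ∈ Y₀), ν Y₀ =
      ∑ κ ∈ univ.filter (fun κ : S → Fin 3 => ((univ.filter (fun s => κ s = 1)).card = A ∧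
        (univ.filter (fun s => κ s = 2)).card = C) ∧ κ s₀ = 2),
        ∏ s, (if κ s = 1 then P s else if κ s = 2 then Q s else 1) := by
    intro s₀
    simp only [hν]; rw [regroup]
    exact Finset.sum_congr (Finset.filter_congr fun κ _ => by simp) fun _ _ => rfl
  have e2 : ∑ Y₀ ∈ univ.filter (fun Y₀ : Finset S => s₁ ∈ Y₀ ∧ s₂ ∈ Y₀), ν Y₀ =
      ∑ κ ∈ univ.filter (fun κ : S → Fin 3 => ((univ.filter (fun s => κ s = 1)).card = A ∧
        (univ.filter (fun s => κ s = 2)).card = C) ∧ (κ s₁ = 2 ∧ κ s₂ = 2)),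
        ∏ s, (if κ s = 1 then P s else if κ s = 2 then Q s else 1) := by
    simp only [hν]; rw [regroup]
    exact Finset.sum_congr (Finset.filter_congr fun κ _ => by simp) fun _ _ => rfl
  rw [e0, e1, e1, e2] at PNC
  exact PNC

end SiteCovariance

end Summit.CriticalPhenomena.PercolationContinuityZ3.Theorems
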